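import Summits.RiemannHypothesis.RiemannHypothesis.Theorems.Splittings.NbDilationA2
import HarnessLib

/-!
# RH-EQUIVALENT·SPLITTING CENSUS (nb, neg) · V45 «DILATION BUDGET», addendum T48h: the exponent-`η ≤ 0` end of the family DIL(η) holds OUTRIGHT; nothing here bears on the truth of RH

LABEL (line 1): RH-EQUIVALENT·SPLITTING (cell `rh-split`, seat (nb, neg), generation 20, census
row V45, by-product T48h).  Companion of `NbDilationBudget.lean` (same namespace), written once the
cell's T47a (`NbDilation.nb_unbounded_dilations`, module `…Splittings.NbDilationA2`) had landed.

* `nb_real_menus` : NB_ℝ — `χ = 𝟙_(0,1]` is an `L²((0,∞))`-limit of finite REAL combinations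
  `∑ c_j {t_j/x}` with `t_j > 0` — OUTRIGHT (flatten `nb_unbounded_dilations` at `θ_j = j+1`: the
  product menu `{(j+1)/(k+1)}` is a finite real menu).  RH-free: Wiener + PNT on the critical line.
* `dil_of_nonpos` : for every `η ≤ 0`, DIL(η) («`∀ δ > 0 ∃ X ≥ 1, ε > 0`, a real menu in `(0,X]`
  with `‖χ - ∑ c_j{t_j/x}‖ < ε` and `ε·X^η < δ`», spelled out verbatim) holds OUTRIGHT (budget
  `X = 1 + ∑ t_j`).  So on the budget-exponent axis the conjunct DIL(η) is EMPTY for `η < 0` and a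
  THEOREM for `η = 0` (the split «DIL(0) ∧ QRH(1/2) ⟹ RH» is DECORATION: QRH(1/2) ⟺ RH), in
  kernel with no hypothesis left.

Hygiene: zero `def`s, no `sorry`, no new axioms, no `instance`/`notation`; imports = the landed
`…Theorems.Splittings.NbDilationA2` + `HarnessLib`.
-/

set_option linter.dupNamespace false

noncomputable section

open MeasureTheory Set
open scoped Real

namespace Summit.RiemannHypothesis.RiemannHypothesis.Theorems.Splittings.NbDilationBudget

open Summit.RiemannHypothesis.RiemannHypothesis.Theorems.Splittings.NbDilation

/-- **NB_ℝ, outright**: for every `ε > 0` there are finitely many real `t_j > 0` and real `c_j`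
with `‖𝟙_(0,1] - ∑ c_j {t_j/x}‖_{L²((0,∞))} < ε`.  Flattening of the cell's T47a
`NbDilation.nb_unbounded_dilations` at the unbounded sequence `θ_j = j + 1` (menu `(j+1)/(k+1)`).
[folklore] (Wiener's `L²` Tauberian theorem + `ζ(1/2+it) ≠ 0` a.e.) -/
theorem nb_real_menus (ε : ℝ) (hε : 0 < ε) :
    ∃ (J : ℕ) (t c : Fin J → ℝ), (∀ j, 0 < t j) ∧
      eLpNorm (fun x : ℝ ↦ (Ioc (0 : ℝ) 1).indicator 1 x -
        ∑ j : Fin J, c j * Int.fract (t j / x)) 2 (volume.restrict (Ioi 0)) <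
          ENNReal.ofReal ε := by
  obtain ⟨J, N, c, hc⟩ := nb_unbounded_dilations (fun j ↦ (j : ℝ) + 1)
    (fun j ↦ by positivity) (fun T ↦ ⟨⌈T⌉₊, by
      have := Nat.le_ceil T
      linarith⟩) ε hε
  -- flatten the product menu `Fin J × Fin N` into one finite real menu
  let e : Fin (J * N) ≃ Fin J × Fin N := finProdFinEquiv.symm
  refine ⟨J * N, fun i ↦ (((e i).1 : ℕ) + 1 : ℝ) / (((e i).2 : ℕ) + 1),
    fun i ↦ c (e i).1 (e i).2, fun i ↦ by positivity, ?_⟩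
  have hfun : (fun x : ℝ ↦ (Ioc (0 : ℝ) 1).indicator 1 x -
      ∑ i : Fin (J * N), c (e i).1 (e i).2 *
        Int.fract ((((e i).1 : ℕ) + 1 : ℝ) / (((e i).2 : ℕ) + 1) / x)) =
      (fun x : ℝ ↦ (Ioc (0 : ℝ) 1).indicator 1 x -
        ∑ j : Fin J, ∑ k : Fin N, c j k *
          Int.fract ((((j : ℕ) : ℝ) + 1) / ((((k : ℕ) : ℝ) + 1) * x))) := by
    funext x
    congr 1
    rw [e.sum_comp (fun p : Fin J × Fin N ↦ c p.1 p.2 *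
      Int.fract ((((p.1 : ℕ) : ℝ) + 1) / (((p.2 : ℕ) : ℝ) + 1) / x)), Fintype.sum_prod_type]
    simp only [div_div]
  rw [hfun]
  exact hc

/-- **T48h — the `η ≤ 0` end of DIL(η) holds OUTRIGHT** (budget `X = 1 + ∑ t_j`, `X^η ≤ 1`, menu
and accuracy from `nb_real_menus`).  For `η < 0` the conjunct DIL(η) of the row's splitting
«DIL(η) ∧ QRH(1/2+η) ⟹ RH» is therefore EMPTY, and for `η = 0` it is a THEOREM (DECORATION:
the other conjunct QRH(1/2) is RH by `quasiRiemannHypothesis_one_half_iff_holds`). [folklore] -/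
theorem dil_of_nonpos {η : ℝ} (hη : η ≤ 0) :
    ∀ δ : ℝ, 0 < δ → ∃ (J : ℕ) (t c : Fin J → ℝ) (X ε : ℝ), 1 ≤ X ∧ 0 < ε ∧
      (∀ j, 0 < t j ∧ t j ≤ X) ∧
      eLpNorm (fun x : ℝ ↦ (Ioc (0 : ℝ) 1).indicator 1 x -
        ∑ j : Fin J, c j * Int.fract (t j / x)) 2 (volume.restrict (Ioi 0)) <
          ENNReal.ofReal ε ∧ ε * X ^ η < δ := by
  intro δ hδ
  obtain ⟨J, t, c, ht, hN⟩ := nb_real_menus (δ / 2) (by positivity)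
  have hsum : 0 ≤ ∑ j, t j := Finset.sum_nonneg fun j _ ↦ (ht j).le
  have hX1 : (1 : ℝ) ≤ 1 + ∑ j, t j := by linarith
  refine ⟨J, t, c, 1 + ∑ j, t j, δ / 2, hX1, by positivity, fun j ↦ ⟨ht j, ?_⟩, hN, ?_⟩
  · have : t j ≤ ∑ i, t i := Finset.single_le_sum (fun i _ ↦ (ht i).le) (Finset.mem_univ j)
    linarith
  · have hle : (1 + ∑ j, t j) ^ η ≤ 1 := Real.rpow_le_one_of_one_le_of_nonpos hX1 hη
    have := mul_le_mul_of_nonneg_left hle (by positivity : (0 : ℝ) ≤ δ / 2)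
    linarith

/-- **DIL(0) is a THEOREM** (the `η = 0` instance, budget-free reading: `ε·X^0 = ε`). [folklore] -/
theorem dil_zero :
    ∀ δ : ℝ, 0 < δ → ∃ (J : ℕ) (t c : Fin J → ℝ) (X ε : ℝ), 1 ≤ X ∧ 0 < ε ∧
      (∀ j, 0 < t j ∧ t j ≤ X) ∧
      eLpNorm (fun x : ℝ ↦ (Ioc (0 : ℝ) 1).indicator 1 x -
        ∑ j : Fin J, c j * Int.fract (t j / x)) 2 (volume.restrict (Ioi 0)) <
          ENNReal.ofReal ε ∧ ε * X ^ (0 : ℝ) < δ :=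
  dil_of_nonpos le_rfl

end Summit.RiemannHypothesis.RiemannHypothesis.Theorems.Splittings.NbDilationBudget

end
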